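import Mathlib
import HarnessLib
import Summits.HubbardSuperconductivity.HubbardSuperconductivity.Theorems.ChiralWindowCwKLChiralWindowChannelBound
import Summits.HubbardSuperconductivity.HubbardSuperconductivity.Theorems.ChiralWindowCwKLChiralWindowD4Invariant
import Summits.HubbardSuperconductivity.HubbardSuperconductivity.Theorems.CwKLChiralWindow.Negative.ChannelStructure
import Summits.HubbardSuperconductivity.HubbardSuperconductivity.Theorems.ChiralWindowCwChannelInfContinuousL2
import Literature.Analysis.OperatorTheory.CompactSelfAdjointBottom
import Literature.Analysis.OperatorTheory.CompactSelfAdjointEigenbasis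
import Literature.Analysis.OperatorTheory.L2KernelIntegralOperator
import Literature.Analysis.OperatorTheory.EigenvectorSpan
import Literature.MathematicalPhysics.QuantumLattice.KohnLuttingerChannelStates

/-!
# Crux `CwKLChiralWindow` (stmt-1741), line `Sketch`: pointwise amplitude bounds for bottom states (node covering)

`stub_klNodeBound`: in the setting of `…ChannelBound` (channel `χ`, base kernel `κ`, trial `Φ`, certified enclosures), in the
equality case `withU ∨ χ ≠ A1g`, with a row bound `∫ κ(k,·)² ≤ R2` a.e. and the multiplicity condition `h < 2ρhi²` (`3ρhi²` on `E`),
every bottom state `ψ` obeys a.e. `|F_Φ(k)| ≤ √N (|L| |ψ(k)| + √R2 √e)` off `E`, `|F_Φ(k)|, |F_Φ(rot³k)| ≤ √N (|L| √(ψ(k)²+ψ(rot k)²) + √R2 √e)`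
on `E` (`F_Φ = ∫ κ Φ`, `L` the Temple bound, `e` Kato's bound): bottom states are eigenvectors (`kl_nb_bottom_eigvec`), the bottom
eigenspace is a line / the rotation plane (multiplicity mass + `Literature…EigenvectorSpan`), the trial is `√e`-close to it (Kato +
orthogonal projection), and the remainder is controlled row-wise (`kl_nb_remainder_ae`). -/

noncomputable section

set_option linter.dupNamespace false

namespace Summit.HubbardSuperconductivity.HubbardSuperconductivity.Theorems

open MeasureTheory Literature.MathematicalPhysics.QuantumLattice Literature.Analysis.OperatorTheory

/-! ### Node covering: bottom states are eigenvectors; Kato; pointwise amplitude bounds -/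

set_option maxHeartbeats 400000 in
/-- **Bottom states are eigenvectors, and the bottom is the Temple eigenvalue.** In the setting of `kl_cb_setup` (equality
case `withU ∨ χ ≠ A1g`): `channelInf ε₀ μ 1 χ = l`, and for every channel state `ψ` attaining the bottom the class `[ψ]`
is a `P`-fixed unit vector with `A [ψ] = l [ψ]`. [folklore] -/
theorem kl_nb_bottom_eigvec {μ : ℝ} (hμ : μ ∈ Set.Ioo (-4 : ℝ) 0) {χ : D4Irrep} {withU : Bool}
    (hU : withU = true → χ = D4Irrep.A1g) (hcase : withU = true ∨ χ ≠ D4Irrep.A1g)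
    {A P : Lp ℝ 2 (fermiCurveMeasure (squareDispersion 1 0) μ) →L[ℝ] Lp ℝ 2 (fermiCurveMeasure (squareDispersion 1 0) μ)}
    {V : Submodule ℝ (Lp ℝ 2 (fermiCurveMeasure (squareDispersion 1 0) μ))} (hmemV : ∀ v, v ∈ V ↔ P v = v)
    {T : V →L[ℝ] V} {l ρhi : ℝ}
    (hAinner : ∀ φ ψ : Lp ℝ 2 (fermiCurveMeasure (squareDispersion 1 0) μ), inner ℝ ψ (A φ) = ∫ k, ψ k * ∫ k', ((if withU then 1 else 0) +
          lindhardFunction (squareDispersion 1 0) μ (k + k')) * φ k'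
        ∂fermiCurveMeasure (squareDispersion 1 0) μ ∂fermiCurveMeasure (squareDispersion 1 0) μ)
    (hAsa : IsSelfAdjoint A) (hAc : IsCompactOperator A) (hAP : A * P = P * A)
    (hPfix : ∀ (ψ : Momentum → ℝ) (hψ : MemLp ψ 2 (fermiCurveMeasure (squareDispersion 1 0) μ)), InChannel χ ψ → P (hψ.toLp ψ) = hψ.toLp ψ)
    (hPrepr : ∀ φ : Lp ℝ 2 (fermiCurveMeasure (squareDispersion 1 0) μ), P φ = φ →
      ∃ ψ : Momentum → ℝ, InChannel χ ψ ∧ MemLp ψ 2 (fermiCurveMeasure (squareDispersion 1 0) μ) ∧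
        (φ : Momentum → ℝ) =ᵐ[fermiCurveMeasure (squareDispersion 1 0) μ] ψ)
    (hT : ∀ v, (T v : Lp ℝ 2 (fermiCurveMeasure (squareDispersion 1 0) μ)) = A v)
    (hl : ∃ v, v ≠ 0 ∧ T v = l • v) (hlρ : l ≤ ρhi) (hρhi0 : ρhi < 0)
    (hray : ∀ y, l * ‖y‖ ^ 2 ≤ inner ℝ y (T y)) :
    channelInf (squareDispersion 1 0) μ 1 χ = l ∧
    ∀ ψ, IsChannelState (squareDispersion 1 0) μ χ ψ →
      pairingForm (squareDispersion 1 0) μ 1 ψ = channelInf (squareDispersion 1 0) μ 1 χ →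
      ∀ hψ : MemLp ψ 2 (fermiCurveMeasure (squareDispersion 1 0) μ), P (hψ.toLp ψ) = hψ.toLp ψ ∧ ‖hψ.toLp ψ‖ = 1 ∧ A (hψ.toLp ψ) = l • hψ.toLp ψ := by
  -- dictionary: a channel state gives a fixed unit vector with Rayleigh quotient `= pairingForm` (equality case)
  have hdict : ∀ ψ, IsChannelState (squareDispersion 1 0) μ χ ψ →
      ∀ hψ : MemLp ψ 2 (fermiCurveMeasure (squareDispersion 1 0) μ), P (hψ.toLp ψ) = hψ.toLp ψ ∧ ‖hψ.toLp ψ‖ = 1 ∧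
      inner ℝ (hψ.toLp ψ) (A (hψ.toLp ψ)) = pairingForm (squareDispersion 1 0) μ 1 ψ := by
    intro ψ hψs hψ
    have hvae : (hψ.toLp ψ : Momentum → ℝ) =ᵐ[fermiCurveMeasure (squareDispersion 1 0) μ] ψ := hψ.coeFn_toLp
    refine ⟨hPfix ψ hψ hψs.2.2, ?_, ?_⟩
    · have h2 : ‖hψ.toLp ψ‖ ^ 2 = 1 := by rw [kl_bs_norm_sq_eq_integral_of_ae_eq hvae, hψs.2.1]
      exact (pow_eq_one_iff_of_nonneg (norm_nonneg _) two_ne_zero).1 h2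
    · rw [kl_bs_inner_eq_of_ae_eq (fun q => (if withU then 1 else 0) + lindhardFunction (squareDispersion 1 0) μ q) A
        hAinner hvae, (kl_cb_pairingForm_ge hμ hU hψs).2 hcase]
  -- lower bound `l ≤ pairingForm`
  have hlow : ∀ ψ, IsChannelState (squareDispersion 1 0) μ χ ψ → l ≤ pairingForm (squareDispersion 1 0) μ 1 ψ := by
    intro ψ hψs
    obtain ⟨hfix, hnorm, hval⟩ := hdict ψ hψs hψs.1
    have h1 := hray ⟨hψs.1.toLp ψ, (hmemV _).2 hfix⟩
    rw [(compression_inner_norm hT _).1] at h1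
    change l * ‖hψs.1.toLp ψ‖ ^ 2 ≤ inner ℝ (hψs.1.toLp ψ) (A (hψs.1.toLp ψ)) at h1
    rw [hnorm, one_pow, mul_one, hval] at h1
    exact h1
  -- an eigenvector of `l`, normalised, and its representative: `channelInf ≤ l`
  obtain ⟨v, hv, hTv⟩ := hl
  have hvn : ‖(v : Lp ℝ 2 (fermiCurveMeasure (squareDispersion 1 0) μ))‖ ≠ 0 := by
    rw [Submodule.norm_coe]; exact norm_ne_zero_iff.2 hv
  obtain ⟨e, henorm, hefix, hAe⟩ : ∃ e : Lp ℝ 2 (fermiCurveMeasure (squareDispersion 1 0) μ), ‖e‖ = 1 ∧ P e = e ∧ A e = l • e := by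
    refine ⟨(‖(v : Lp ℝ 2 (fermiCurveMeasure (squareDispersion 1 0) μ))‖⁻¹ : ℝ) •
      (v : Lp ℝ 2 (fermiCurveMeasure (squareDispersion 1 0) μ)), ?_, ?_, ?_⟩
    · rw [norm_smul, Real.norm_eq_abs, abs_of_pos (inv_pos.2 ((norm_nonneg _).lt_of_ne hvn.symm)), inv_mul_cancel₀ hvn]
    · rw [map_smul, (hmemV _).1 v.2]
    · have h1 : A (v : Lp ℝ 2 (fermiCurveMeasure (squareDispersion 1 0) μ)) =
          l • (v : Lp ℝ 2 (fermiCurveMeasure (squareDispersion 1 0) μ)) := by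
        rw [← hT, hTv, Submodule.coe_smul]
      rw [map_smul, h1, smul_comm]
  have heval : inner ℝ e (A e) = l := by
    rw [hAe, real_inner_smul_right, real_inner_self_eq_norm_sq, henorm]; ring
  obtain ⟨ψe, hche, hmeme, haee⟩ := hPrepr e hefix
  have hstate_e : IsChannelState (squareDispersion 1 0) μ χ ψe :=
    ⟨hmeme, by rw [← kl_bs_norm_sq_eq_integral_of_ae_eq haee, henorm, one_pow], hche⟩
  have hval_e : pairingForm (squareDispersion 1 0) μ 1 ψe = l := by
    rw [(kl_cb_pairingForm_ge hμ hU hstate_e).2 hcase, ← heval,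
      kl_bs_inner_eq_of_ae_eq (fun q => (if withU then 1 else 0) + lindhardFunction (squareDispersion 1 0) μ q) A
        hAinner haee]
  have hne : ((pairingForm (squareDispersion 1 0) μ 1) '' {ψ | IsChannelState (squareDispersion 1 0) μ χ ψ}).Nonempty :=
    ⟨_, ψe, hstate_e, rfl⟩
  have hbdd : BddBelow ((pairingForm (squareDispersion 1 0) μ 1) '' {ψ | IsChannelState (squareDispersion 1 0) μ χ ψ}) :=
    ⟨l, by rintro r ⟨ψ, hψ, rfl⟩; exact hlow ψ hψ⟩
  have hinf : channelInf (squareDispersion 1 0) μ 1 χ = l := by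
    apply le_antisymm
    · exact (csInf_le hbdd ⟨ψe, hstate_e, rfl⟩).trans hval_e.le
    · exact le_csInf hne (by rintro r ⟨ψ, hψ, rfl⟩; exact hlow ψ hψ)
  refine ⟨hinf, fun ψ hψs hbot hψ => ?_⟩
  obtain ⟨hfix, hnorm, hval⟩ := hdict ψ hψs hψ
  refine ⟨hfix, hnorm, ?_⟩
  -- the unit minimiser is an eigenvector (Literature: compact self-adjoint, commuting projection)
  have hGLB : IsGLB {r : ℝ | ∃ x : Lp ℝ 2 (fermiCurveMeasure (squareDispersion 1 0) μ), P x = x ∧ ‖x‖ = 1 ∧ inner ℝ x (A x) = r} l := by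
    refine ⟨?_, fun r hr => hr ⟨e, hefix, henorm, heval⟩⟩
    rintro r ⟨y, hyfix, hynorm, rfl⟩
    have h1 := hray ⟨y, (hmemV _).2 hyfix⟩
    rw [(compression_inner_norm hT _).1] at h1
    change l * ‖y‖ ^ 2 ≤ inner ℝ y (A y) at h1
    rw [hynorm, one_pow, mul_one] at h1
    exact h1
  have hl0 : l < 0 := lt_of_le_of_lt hlρ hρhi0
  exact (exists_rayleigh_eq_of_isGLB_of_neg_of_commute_real hAsa hAc hAP hGLB hl0).2 _ hfix hnorm
    (by rw [hval, hbot, hinf])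

/-- **Pointwise control of the remainder.** If `A` acts a.e. by an `L²(σ⊗σ)` kernel `κ` whose rows have `∫ κ(k,·)² ≤ R2`
for a.e. `k`, then for `η ∈ L²(σ)`: `|(A η)(k)| ≤ √R2 · ‖η‖` for a.e. `k`. [folklore] -/
theorem kl_nb_remainder_ae {μ : ℝ} (hμ : μ ∈ Set.Ioo (-4 : ℝ) 0) (κ : Momentum → Momentum → ℝ)
    (hκ2 : MemLp (Function.uncurry κ) 2
      ((fermiCurveMeasure (squareDispersion 1 0) μ).prod (fermiCurveMeasure (squareDispersion 1 0) μ)))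
    {A : Lp ℝ 2 (fermiCurveMeasure (squareDispersion 1 0) μ) →L[ℝ] Lp ℝ 2 (fermiCurveMeasure (squareDispersion 1 0) μ)}
    (hA : ∀ φ : Lp ℝ 2 (fermiCurveMeasure (squareDispersion 1 0) μ), (A φ : Momentum → ℝ) =ᵐ[fermiCurveMeasure (squareDispersion 1 0) μ]
        fun k => ∫ k', κ k k' * φ k' ∂fermiCurveMeasure (squareDispersion 1 0) μ)
    {R2 : ℝ} (hR : ∀ᵐ k ∂fermiCurveMeasure (squareDispersion 1 0) μ, ∫ k', κ k k' ^ 2 ∂fermiCurveMeasure (squareDispersion 1 0) μ ≤ R2)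
    (η : Lp ℝ 2 (fermiCurveMeasure (squareDispersion 1 0) μ)) :
    ∀ᵐ k ∂fermiCurveMeasure (squareDispersion 1 0) μ, |(A η : Momentum → ℝ) k| ≤ Real.sqrt R2 * ‖η‖ := by
  haveI : IsFiniteMeasure (fermiCurveMeasure (squareDispersion 1 0) μ) :=
    stub_klFiniteMeasure stub_klGradient stub_klHausdorffFinite μ hμ
  have hη : MemLp (η : Momentum → ℝ) 2 (fermiCurveMeasure (squareDispersion 1 0) μ) := Lp.memLp η
  have hηnorm : Real.sqrt (∫ k, (η : Momentum → ℝ) k ^ 2 ∂fermiCurveMeasure (squareDispersion 1 0) μ) = ‖η‖ := by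
    rw [← kl_bs_norm_sq_eq_integral η, Real.sqrt_sq (norm_nonneg _)]
  filter_upwards [hA η, hR, ae_memLp_l2Kernel_section hκ2] with k hk hRk hsec
  rw [hk]
  calc |∫ k', κ k k' * η k' ∂fermiCurveMeasure (squareDispersion 1 0) μ|
      ≤ Real.sqrt (∫ k', κ k k' ^ 2 ∂fermiCurveMeasure (squareDispersion 1 0) μ) *
          Real.sqrt (∫ k', (η : Momentum → ℝ) k' ^ 2 ∂fermiCurveMeasure (squareDispersion 1 0) μ) :=
        abs_integral_mul_le_sqrt_mul_sqrt hsec hη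
    _ ≤ Real.sqrt R2 * ‖η‖ := by
        rw [hηnorm]
        exact mul_le_mul_of_nonneg_right (Real.sqrt_le_sqrt hRk) (norm_nonneg _)

/-- Two-dimensional Cauchy–Schwarz: `|a s + b t| ≤ √(s² + t²)` when `a² + b² ≤ 1`. [folklore] -/
theorem kl_nb_cs_two {a b s t : ℝ} (hab : a ^ 2 + b ^ 2 ≤ 1) : |a * s + b * t| ≤ Real.sqrt (s ^ 2 + t ^ 2) := by
  rw [← Real.sqrt_sq_eq_abs]
  apply Real.sqrt_le_sqrt
  nlinarith [sq_nonneg (a * t - b * s), sq_nonneg s, sq_nonneg t, mul_le_mul_of_nonneg_right hab (add_nonneg (sq_nonneg s) (sq_nonneg t))]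

set_option maxHeartbeats 1600000 in
/-- **Pointwise amplitude bounds for bottom states** (`stub_klNodeBound`). In the setting of `stub_klChannelBound` (equality case
`withU ∨ χ ≠ A1g`), with a row bound `∫ κ(k,·)² ≤ R2` a.e. and the multiplicity condition `h < 2ρhi²` (`h < 3ρhi²` for `E`): every
channel state `ψ` attaining the bottom controls the trial amplitude `F_Φ(k) = ∫ κ(k,k') Φ(k') dσ` pointwise a.e.,
`|F_Φ(k)| ≤ √N (|L| |ψ(k)| + √R2 √e)` off `E` and `|F_Φ(k)|, |F_Φ(rot³k)| ≤ √N (|L| √(ψ(k)² + ψ(rot k)²) + √R2 √e)` on `E`, where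
`L = min f(ρlo) f(ρhi)` is the Temple bound and `e = (α - ρhi²)/(β - ρhi)²` Kato's distance bound (bottom states are
eigenvectors; the bottom eigenspace is the line through `[ψ]`, resp. the plane through `[ψ], [ψ∘rot]`; the normalised trial is
within `√e` of it; the remainder is controlled row-wise by Cauchy–Schwarz). [folklore] -/
theorem stub_klNodeBound : ∀ μ ∈ Set.Ioo (-4 : ℝ) 0, ∀ (χ : D4Irrep) (withU : Bool) (M : ℕ) (c : Fin M → ℝ)
    (u : Fin M → Momentum → ℝ) (Φ : Momentum → ℝ) (ρlo ρhi α h β R2 : ℝ),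
    (withU = true → χ = D4Irrep.A1g) → (∀ m, 0 ≤ c m) →
    (∀ m, MemLp (u m) 2 (fermiCurveMeasure (squareDispersion 1 0) μ)) →
    MemLp Φ 2 (fermiCurveMeasure (squareDispersion 1 0) μ) → InChannel χ Φ →
    0 < ∫ k, Φ k ^ 2 ∂fermiCurveMeasure (squareDispersion 1 0) μ →
    ρlo * ∫ k, Φ k ^ 2 ∂fermiCurveMeasure (squareDispersion 1 0) μ ≤
      ∫ k, Φ k * ∫ k', ((if withU then 1 else 0) + lindhardFunction (squareDispersion 1 0) μ (k + k')) * Φ k'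
        ∂fermiCurveMeasure (squareDispersion 1 0) μ ∂fermiCurveMeasure (squareDispersion 1 0) μ →
    ∫ k, Φ k * ∫ k', ((if withU then 1 else 0) + lindhardFunction (squareDispersion 1 0) μ (k + k')) * Φ k'
        ∂fermiCurveMeasure (squareDispersion 1 0) μ ∂fermiCurveMeasure (squareDispersion 1 0) μ ≤
      ρhi * ∫ k, Φ k ^ 2 ∂fermiCurveMeasure (squareDispersion 1 0) μ →
    ρhi < 0 →
    ∫ k, (∫ k', ((if withU then 1 else 0) + lindhardFunction (squareDispersion 1 0) μ (k + k')) * Φ k'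
        ∂fermiCurveMeasure (squareDispersion 1 0) μ) ^ 2 ∂fermiCurveMeasure (squareDispersion 1 0) μ ≤
      α * ∫ k, Φ k ^ 2 ∂fermiCurveMeasure (squareDispersion 1 0) μ →
    ∫ z, (d4Project χ (fun q => (if withU then 1 else 0) + lindhardFunction (squareDispersion 1 0) μ (z.1 + q)) z.2 -
        ∑ m, c m * (u m z.1 * u m z.2)) ^ 2
        ∂(fermiCurveMeasure (squareDispersion 1 0) μ).prod (fermiCurveMeasure (squareDispersion 1 0) μ) ≤ h →
    β ≤ 0 → h - (if χ = D4Irrep.E then 2 else 1) * ρhi ^ 2 ≤ β ^ 2 → ρhi < β →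
    (withU = true ∨ χ ≠ D4Irrep.A1g) → 0 ≤ R2 →
    (∀ᵐ k ∂fermiCurveMeasure (squareDispersion 1 0) μ, ∫ k', ((if withU then 1 else 0) + lindhardFunction (squareDispersion 1 0) μ (k + k')) ^ 2
        ∂fermiCurveMeasure (squareDispersion 1 0) μ ≤ R2) →
    h < (if χ = D4Irrep.E then 3 else 2) * ρhi ^ 2 →
    ∀ ψ : Momentum → ℝ, IsChannelState (squareDispersion 1 0) μ χ ψ →
      pairingForm (squareDispersion 1 0) μ 1 ψ = channelInf (squareDispersion 1 0) μ 1 χ →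
      (χ ≠ D4Irrep.E → ∀ᵐ k ∂fermiCurveMeasure (squareDispersion 1 0) μ,
        |∫ k', ((if withU then 1 else 0) + lindhardFunction (squareDispersion 1 0) μ (k + k')) * Φ k'
            ∂fermiCurveMeasure (squareDispersion 1 0) μ| ≤
          Real.sqrt (∫ k, Φ k ^ 2 ∂fermiCurveMeasure (squareDispersion 1 0) μ) *
            (|min ((β * ρlo - α) / (β - ρlo)) ((β * ρhi - α) / (β - ρhi))| * |ψ k| +
              Real.sqrt R2 * Real.sqrt ((α - ρhi ^ 2) / (β - ρhi) ^ 2))) ∧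
      (χ = D4Irrep.E → ∀ᵐ k ∂fermiCurveMeasure (squareDispersion 1 0) μ,
        |∫ k', ((if withU then 1 else 0) + lindhardFunction (squareDispersion 1 0) μ (k + k')) * Φ k'
            ∂fermiCurveMeasure (squareDispersion 1 0) μ| ≤
          Real.sqrt (∫ k, Φ k ^ 2 ∂fermiCurveMeasure (squareDispersion 1 0) μ) *
            (|min ((β * ρlo - α) / (β - ρlo)) ((β * ρhi - α) / (β - ρhi))| * Real.sqrt (ψ k ^ 2 + ψ (rotMomentum k) ^ 2) +
              Real.sqrt R2 * Real.sqrt ((α - ρhi ^ 2) / (β - ρhi) ^ 2)) ∧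
        |∫ k', ((if withU then 1 else 0) + lindhardFunction (squareDispersion 1 0) μ
              (rotMomentum (rotMomentum (rotMomentum k)) + k')) * Φ k' ∂fermiCurveMeasure (squareDispersion 1 0) μ| ≤
          Real.sqrt (∫ k, Φ k ^ 2 ∂fermiCurveMeasure (squareDispersion 1 0) μ) *
            (|min ((β * ρlo - α) / (β - ρlo)) ((β * ρhi - α) / (β - ρhi))| * Real.sqrt (ψ k ^ 2 + ψ (rotMomentum k) ^ 2) +
              Real.sqrt R2 * Real.sqrt ((α - ρhi ^ 2) / (β - ρhi) ^ 2))) := by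
  intro μ hμ χ withU M c u Φ ρlo ρhi α h β R2 hU hc hu hΦ hΦch hN hρlo hρhi hρhi0 hα hH hβ0 hβ hρβ hcase hR2 hR hmul ψ hψs hbot
  haveI : IsFiniteMeasure (fermiCurveMeasure (squareDispersion 1 0) μ) :=
    stub_klFiniteMeasure stub_klGradient stub_klHausdorffFinite μ hμ
  obtain ⟨A, P, U₁, V, T, x, l, hmemV, hVc, hA, hAinner, hAsa, hAc, hAP, hPfix, hPrepr, hU₁ae, hAU, hPU, hUinner, hEskew, hT,
    hxnorm, hxdef, hl, hlρ, hLl, hray, -, hkato, hmass⟩ :=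
    kl_cb_setup hμ χ withU hU hu hc hΦ hΦch hN hρlo hρhi hρhi0 hα hH hβ0 hβ hρβ
  haveI : CompleteSpace V := hVc
  have hκ2 := kl_co_baseKernel_memLp hμ (if withU then 1 else 0)
  -- the bottom state as an eigenvector, and `channelInf = l`
  obtain ⟨-, heig⟩ := kl_nb_bottom_eigvec hμ hU hcase hmemV hAinner hAsa hAc hAP hPfix hPrepr hT hl hlρ hρhi0 hray
  obtain ⟨hwfix, hwnorm, hAw⟩ := heig ψ hψs hbot hψs.1
  have hwae : (hψs.1.toLp ψ : Momentum → ℝ) =ᵐ[fermiCurveMeasure (squareDispersion 1 0) μ] ψ := hψs.1.coeFn_toLp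
  obtain ⟨wV, hwV⟩ : ∃ wV : V, (wV : Lp ℝ 2 (fermiCurveMeasure (squareDispersion 1 0) μ)) = hψs.1.toLp ψ :=
    ⟨⟨_, (hmemV _).2 hwfix⟩, rfl⟩
  have hTwV : T wV = l • wV := Subtype.ext (by rw [hT, Submodule.coe_smul, hwV]; exact hAw)
  have hwVnorm : ‖wV‖ = 1 := by rw [Submodule.coe_norm, hwV, hwnorm]
  -- `|l| ≤ |L|`
  have hl0 : l < 0 := lt_of_le_of_lt hlρ hρhi0
  have hlL : |l| ≤ |min ((β * ρlo - α) / (β - ρlo)) ((β * ρhi - α) / (β - ρhi))| := by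
    rw [abs_of_neg hl0, abs_of_neg (lt_of_le_of_lt hLl hl0)]; linarith
  -- Kato, upgraded to the orthogonal projection onto the eigenspace `K`
  haveI : CompleteSpace (Module.End.eigenspace (T : Module.End ℝ V) l) := (isClosed_eigenspace T l).completeSpace_coe
  have hmemK : ∀ v : V, v ∈ Module.End.eigenspace (T : Module.End ℝ V) l ↔ T v = l • v := fun v => by
    rw [Module.End.mem_eigenspace_iff]; rfl
  obtain ⟨v₀, hTv₀, hdist₀⟩ := hkato
  obtain ⟨v, hv⟩ : ∃ v : V, v = (Module.End.eigenspace (T : Module.End ℝ V) l).starProjection x := ⟨_, rfl⟩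
  obtain ⟨hvclose, hvle, -⟩ := norm_sub_starProjection_le_of_mem (𝕜 := ℝ) (Module.End.eigenspace (T : Module.End ℝ V) l) x
    ((hmemK v₀).2 hTv₀)
  rw [← hv] at hvclose hvle
  have hTv : T v = l • v := (hmemK v).1 (hv ▸ (Module.End.eigenspace (T : Module.End ℝ V) l).starProjection_apply_mem x)
  have hvnorm : ‖v‖ ≤ 1 := hvle.trans hxnorm.le
  have hηnorm : ‖x - v‖ ≤ Real.sqrt ((α - ρhi ^ 2) / (β - ρhi) ^ 2) := by
    rw [← Real.sqrt_sq (norm_nonneg (x - v))]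
    exact Real.sqrt_le_sqrt ((pow_le_pow_left₀ (norm_nonneg _) hvclose 2).trans hdist₀)
  -- a.e. identity for `A x`
  have hsqrtN : 0 < Real.sqrt (∫ k, Φ k ^ 2 ∂fermiCurveMeasure (squareDispersion 1 0) μ) := Real.sqrt_pos.2 hN
  have hAx : (A (x : Lp ℝ 2 (fermiCurveMeasure (squareDispersion 1 0) μ)) : Momentum → ℝ)
      =ᵐ[fermiCurveMeasure (squareDispersion 1 0) μ] fun k =>
        (Real.sqrt (∫ k, Φ k ^ 2 ∂fermiCurveMeasure (squareDispersion 1 0) μ))⁻¹ *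
          ∫ k', ((if withU then 1 else 0) + lindhardFunction (squareDispersion 1 0) μ (k + k')) * Φ k'
            ∂fermiCurveMeasure (squareDispersion 1 0) μ := by
    rw [hxdef, map_smul]
    filter_upwards [Lp.coeFn_smul (Real.sqrt (∫ k, Φ k ^ 2 ∂fermiCurveMeasure (squareDispersion 1 0) μ))⁻¹ (A (hΦ.toLp Φ)), hA (hΦ.toLp Φ)] with k hk hk'
    rw [hk, Pi.smul_apply, hk', smul_eq_mul,
      kl_bs_kernelIntegral_congr (fun q => (if withU then 1 else 0) + lindhardFunction (squareDispersion 1 0) μ q) hΦ.coeFn_toLp k]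
  -- the two cases
  refine ⟨fun hE => ?_, fun hE => ?_⟩
  · -- `χ ≠ E`: the eigenspace is the line through `wV`
    have hno : ∀ f : Fin 2 → V, Orthonormal ℝ f → (∀ j, T (f j) = l • f j) → False := by
      intro f hf heigf
      have h1 := hmass 2 f hf heigf
      have h2 : h < 2 * ρhi ^ 2 := by simpa [hE] using hmul
      push_cast at h1
      linarith
    have hvspan : v = (inner ℝ wV v) • wV := eq_smul_of_no_orthonormal_pair T l hwVnorm hTwV hno hTv
    have ha : |inner ℝ wV v| ≤ 1 := by
      have := abs_real_inner_le_norm wV v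
      rw [hwVnorm, one_mul] at this
      exact this.trans hvnorm
    -- the remainder `η = x - a w`
    obtain ⟨η, hη⟩ : ∃ η : Lp ℝ 2 (fermiCurveMeasure (squareDispersion 1 0) μ),
        η = (x : Lp ℝ 2 (fermiCurveMeasure (squareDispersion 1 0) μ)) - (inner ℝ wV v) • hψs.1.toLp ψ := ⟨_, rfl⟩
    have hvH : (v : Lp ℝ 2 (fermiCurveMeasure (squareDispersion 1 0) μ)) = (inner ℝ wV v) • hψs.1.toLp ψ := by
      conv_lhs => rw [hvspan]
      rw [Submodule.coe_smul, hwV]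
    have hηeq : η = ((x - v : V) : Lp ℝ 2 (fermiCurveMeasure (squareDispersion 1 0) μ)) := by
      rw [hη, Submodule.coe_sub, hvH]
    have hηnorm' : ‖η‖ ≤ Real.sqrt ((α - ρhi ^ 2) / (β - ρhi) ^ 2) := by rw [hηeq, Submodule.norm_coe]; exact hηnorm
    have hrem := kl_nb_remainder_ae hμ _ hκ2 hA hR η
    have hAη : (A η : Momentum → ℝ) =ᵐ[fermiCurveMeasure (squareDispersion 1 0) μ] fun k =>
        (Real.sqrt (∫ k, Φ k ^ 2 ∂fermiCurveMeasure (squareDispersion 1 0) μ))⁻¹ *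
            (∫ k', ((if withU then 1 else 0) + lindhardFunction (squareDispersion 1 0) μ (k + k')) * Φ k'
              ∂fermiCurveMeasure (squareDispersion 1 0) μ) - inner ℝ wV v * l * ψ k := by
      have h1 : A η = A (x : Lp ℝ 2 (fermiCurveMeasure (squareDispersion 1 0) μ)) - (inner ℝ wV v * l) • hψs.1.toLp ψ := by
        rw [hη, map_sub, map_smul, hAw, smul_smul]
      rw [h1]
      filter_upwards [Lp.coeFn_sub (A (x : Lp ℝ 2 (fermiCurveMeasure (squareDispersion 1 0) μ))) ((inner ℝ wV v * l) • hψs.1.toLp ψ),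
        Lp.coeFn_smul (inner ℝ wV v * l) (hψs.1.toLp ψ), hAx, hwae] with k hk1 hk2 hk3 hk4
      rw [hk1, Pi.sub_apply, hk2, Pi.smul_apply, hk3, hk4, smul_eq_mul]
    filter_upwards [hrem, hAη] with k hk hk'
    rw [hk'] at hk
    have h3 := (abs_sub_abs_le_abs_sub _ _).trans (hk.trans (mul_le_mul_of_nonneg_left hηnorm' (Real.sqrt_nonneg _)))
    have h4 : |inner ℝ wV v * l * ψ k| ≤ |min ((β * ρlo - α) / (β - ρlo)) ((β * ρhi - α) / (β - ρhi))| * |ψ k| := by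
      rw [abs_mul, abs_mul]
      exact mul_le_mul_of_nonneg_right (by nlinarith [abs_nonneg (inner ℝ wV v), abs_nonneg l]) (abs_nonneg _)
    rw [abs_mul, abs_of_pos (inv_pos.2 hsqrtN), ← div_eq_inv_mul, sub_le_iff_le_add, div_le_iff₀ hsqrtN] at h3
    nlinarith [h3, h4, Real.sqrt_nonneg R2, Real.sqrt_nonneg ((α - ρhi ^ 2) / (β - ρhi) ^ 2), hsqrtN.le, mul_le_mul_of_nonneg_right h4 hsqrtN.le]
  · -- `χ = E`: the eigenspace is the plane through `wV`, `U₁ wV`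
    have hUV : ∀ y ∈ V, U₁ y ∈ V := by
      intro y hy
      rw [hmemV] at hy ⊢
      have h1 := congrArg (fun f => f y) hPU
      simp only [mul_apply_eq_comp] at h1
      rw [hy] at h1
      exact h1
    have hAw₂ : A (U₁ (hψs.1.toLp ψ)) = l • U₁ (hψs.1.toLp ψ) := by
      change (A * U₁) (hψs.1.toLp ψ) = l • U₁ (hψs.1.toLp ψ)
      rw [hAU, mul_apply_eq_comp, hAw, map_smul]
    obtain ⟨w₂V, hw₂V⟩ : ∃ w₂V : V, (w₂V : Lp ℝ 2 (fermiCurveMeasure (squareDispersion 1 0) μ)) = U₁ (hψs.1.toLp ψ) :=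
      ⟨⟨_, hUV _ ((hmemV _).2 hwfix)⟩, rfl⟩
    have hTw₂V : T w₂V = l • w₂V := Subtype.ext (by rw [hT, Submodule.coe_smul, hw₂V]; exact hAw₂)
    have hw₂norm : ‖w₂V‖ = 1 := by
      have h0 : ‖(w₂V : Lp ℝ 2 (fermiCurveMeasure (squareDispersion 1 0) μ))‖ ^ 2 = ‖hψs.1.toLp ψ‖ ^ 2 := by
        rw [hw₂V, ← real_inner_self_eq_norm_sq, ← real_inner_self_eq_norm_sq, hUinner]
      rw [hwnorm] at h0
      have h1 : ‖(w₂V : Lp ℝ 2 (fermiCurveMeasure (squareDispersion 1 0) μ))‖ = 1 := by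
        nlinarith [norm_nonneg (w₂V : Lp ℝ 2 (fermiCurveMeasure (squareDispersion 1 0) μ))]
      exact h1
    have h12 : inner ℝ wV w₂V = 0 := by
      rw [Submodule.coe_inner, hwV, hw₂V]; exact hEskew hE _ hwfix
    have hno : ∀ f : Fin 3 → V, Orthonormal ℝ f → (∀ j, T (f j) = l • f j) → False := by
      intro f hf heigf
      have h1 := hmass 3 f hf heigf
      have h2 : h < 3 * ρhi ^ 2 := by simpa [hE] using hmul
      push_cast at h1
      linarith
    have hvspan : v = (inner ℝ wV v) • wV + (inner ℝ w₂V v) • w₂V := eq_add_smul_of_no_orthonormal_triple T l hwVnorm hw₂norm h12 hTwV hTw₂V hno hTv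
    have hvH : (v : Lp ℝ 2 (fermiCurveMeasure (squareDispersion 1 0) μ)) =
        (inner ℝ wV v) • hψs.1.toLp ψ + (inner ℝ w₂V v) • U₁ (hψs.1.toLp ψ) := by
      conv_lhs => rw [hvspan]
      rw [Submodule.coe_add, Submodule.coe_smul, Submodule.coe_smul, hwV, hw₂V]
    have hab : (inner ℝ wV v) ^ 2 + (inner ℝ w₂V v) ^ 2 ≤ 1 := by
      have hw2n : ‖U₁ (hψs.1.toLp ψ)‖ = 1 := by rw [← hw₂V]; exact hw₂norm
      have h12H : inner ℝ (hψs.1.toLp ψ) (U₁ (hψs.1.toLp ψ)) = 0 := hEskew hE _ hwfix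
      have h21H : inner ℝ (U₁ (hψs.1.toLp ψ)) (hψs.1.toLp ψ) = 0 := by rw [real_inner_comm]; exact h12H
      have h1 : ‖(v : Lp ℝ 2 (fermiCurveMeasure (squareDispersion 1 0) μ))‖ ^ 2 = (inner ℝ wV v) ^ 2 + (inner ℝ w₂V v) ^ 2 := by
        rw [hvH, ← real_inner_self_eq_norm_sq, inner_add_left, inner_add_right, inner_add_right, real_inner_smul_left,
          real_inner_smul_left, real_inner_smul_left, real_inner_smul_left, real_inner_smul_right, real_inner_smul_right,
          real_inner_smul_right, real_inner_smul_right, real_inner_self_eq_norm_sq, real_inner_self_eq_norm_sq, hwnorm, hw2n, h12H, h21H]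
        ring
      have h2 : ‖(v : Lp ℝ 2 (fermiCurveMeasure (squareDispersion 1 0) μ))‖ ≤ 1 := by rw [Submodule.norm_coe]; exact hvnorm
      nlinarith [norm_nonneg (v : Lp ℝ 2 (fermiCurveMeasure (squareDispersion 1 0) μ))]
    -- the remainder
    obtain ⟨η, hη⟩ : ∃ η : Lp ℝ 2 (fermiCurveMeasure (squareDispersion 1 0) μ), η = (x : Lp ℝ 2 (fermiCurveMeasure (squareDispersion 1 0) μ)) -
          ((inner ℝ wV v) • hψs.1.toLp ψ + (inner ℝ w₂V v) • U₁ (hψs.1.toLp ψ)) := ⟨_, rfl⟩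
    have hηeq : η = ((x - v : V) : Lp ℝ 2 (fermiCurveMeasure (squareDispersion 1 0) μ)) := by
      rw [hη, Submodule.coe_sub, hvH]
    have hηnorm' : ‖η‖ ≤ Real.sqrt ((α - ρhi ^ 2) / (β - ρhi) ^ 2) := by rw [hηeq, Submodule.norm_coe]; exact hηnorm
    have hrem := kl_nb_remainder_ae hμ _ hκ2 hA hR η
    have hrot : MeasurePreserving rotMomentum (fermiCurveMeasure (squareDispersion 1 0) μ)
        (fermiCurveMeasure (squareDispersion 1 0) μ) := stub_klD4Invariant stub_klGradient μ hμ (DihedralGroup.r 1)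
    have hw₂ae : (U₁ (hψs.1.toLp ψ) : Momentum → ℝ) =ᵐ[fermiCurveMeasure (squareDispersion 1 0) μ] fun k => ψ (rotMomentum k) := by
      filter_upwards [hU₁ae (hψs.1.toLp ψ), hrot.quasiMeasurePreserving.ae_eq hwae] with k hk hk'
      rw [hk]; exact hk'
    have hAη : (A η : Momentum → ℝ) =ᵐ[fermiCurveMeasure (squareDispersion 1 0) μ] fun k =>
        (Real.sqrt (∫ k, Φ k ^ 2 ∂fermiCurveMeasure (squareDispersion 1 0) μ))⁻¹ *
            (∫ k', ((if withU then 1 else 0) + lindhardFunction (squareDispersion 1 0) μ (k + k')) * Φ k'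
              ∂fermiCurveMeasure (squareDispersion 1 0) μ) -
          l * (inner ℝ wV v * ψ k + inner ℝ w₂V v * ψ (rotMomentum k)) := by
      have h1 : A η = A (x : Lp ℝ 2 (fermiCurveMeasure (squareDispersion 1 0) μ)) -
          ((l * inner ℝ wV v) • hψs.1.toLp ψ + (l * inner ℝ w₂V v) • U₁ (hψs.1.toLp ψ)) := by
        rw [hη, map_sub, map_add, map_smul, map_smul, hAw, hAw₂, smul_smul, smul_smul, mul_comm (inner ℝ wV v) l, mul_comm (inner ℝ w₂V v) l]
      rw [h1]
      filter_upwards [Lp.coeFn_sub (A (x : Lp ℝ 2 (fermiCurveMeasure (squareDispersion 1 0) μ)))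
          ((l * inner ℝ wV v) • hψs.1.toLp ψ + (l * inner ℝ w₂V v) • U₁ (hψs.1.toLp ψ)),
        Lp.coeFn_add ((l * inner ℝ wV v) • hψs.1.toLp ψ) ((l * inner ℝ w₂V v) • U₁ (hψs.1.toLp ψ)),
        Lp.coeFn_smul (l * inner ℝ wV v) (hψs.1.toLp ψ), Lp.coeFn_smul (l * inner ℝ w₂V v) (U₁ (hψs.1.toLp ψ)), hAx, hwae, hw₂ae]
        with k hk1 hk2 hk3 hk4 hk5 hk6 hk7
      rw [hk1, Pi.sub_apply, hk2, Pi.add_apply, hk3, hk4, Pi.smul_apply, Pi.smul_apply, hk5, hk6, hk7, smul_eq_mul, smul_eq_mul]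
      ring
    -- the pointwise statement at `k`
    have hpt : ∀ᵐ k ∂fermiCurveMeasure (squareDispersion 1 0) μ, |∫ k', ((if withU then 1 else 0) + lindhardFunction (squareDispersion 1 0) μ (k + k')) * Φ k'
            ∂fermiCurveMeasure (squareDispersion 1 0) μ| ≤
          Real.sqrt (∫ k, Φ k ^ 2 ∂fermiCurveMeasure (squareDispersion 1 0) μ) *
            (|min ((β * ρlo - α) / (β - ρlo)) ((β * ρhi - α) / (β - ρhi))| * Real.sqrt (ψ k ^ 2 + ψ (rotMomentum k) ^ 2) +
              Real.sqrt R2 * Real.sqrt ((α - ρhi ^ 2) / (β - ρhi) ^ 2)) := by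
      filter_upwards [hrem, hAη] with k hk hk'
      rw [hk'] at hk
      have h3 := (abs_sub_abs_le_abs_sub _ _).trans (hk.trans (mul_le_mul_of_nonneg_left hηnorm' (Real.sqrt_nonneg _)))
      have h4 : |l * (inner ℝ wV v * ψ k + inner ℝ w₂V v * ψ (rotMomentum k))| ≤
          |min ((β * ρlo - α) / (β - ρlo)) ((β * ρhi - α) / (β - ρhi))| * Real.sqrt (ψ k ^ 2 + ψ (rotMomentum k) ^ 2) := by
        rw [abs_mul]
        exact mul_le_mul hlL (kl_nb_cs_two hab) (abs_nonneg _) (abs_nonneg _)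
      rw [abs_mul, abs_of_pos (inv_pos.2 hsqrtN), ← div_eq_inv_mul, sub_le_iff_le_add, div_le_iff₀ hsqrtN] at h3
      nlinarith [h3, h4, Real.sqrt_nonneg R2, Real.sqrt_nonneg ((α - ρhi ^ 2) / (β - ρhi) ^ 2), hsqrtN.le, mul_le_mul_of_nonneg_right h4 hsqrtN.le]
    -- and transported by `rot³`
    have hrot3 : MeasurePreserving (fun k => rotMomentum (rotMomentum (rotMomentum k)))
        (fermiCurveMeasure (squareDispersion 1 0) μ) (fermiCurveMeasure (squareDispersion 1 0) μ) :=
      stub_klD4Invariant stub_klGradient μ hμ (DihedralGroup.r 3)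
    have hodd : ∀ k, ψ (-k) = -ψ k := (inChannel_E_iff_odd ψ).1 (hE ▸ hψs.2.2)
    filter_upwards [hpt, hrot3.quasiMeasurePreserving.ae hpt] with k hk hk3
    refine ⟨hk, ?_⟩
    have h1 : ψ (rotMomentum (rotMomentum (rotMomentum k))) ^ 2 + ψ (rotMomentum (rotMomentum (rotMomentum (rotMomentum k)))) ^ 2 =
        ψ k ^ 2 + ψ (rotMomentum k) ^ 2 := by
      rw [kl_d4_rot_rot_rot_rot, CwKLChiralWindow.Negative.rot_rot (rotMomentum k), hodd]
      ring
    rw [h1] at hk3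
    exact hk3

end Summit.HubbardSuperconductivity.HubbardSuperconductivity.Theorems

end
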